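import Literature.Analysis.FluidPDE.ElgindiWkProductRule
import Literature.Analysis.FluidPDE.ElgindiHkTriangle
import Literature.Analysis.FluidPDE.ElgindiHkClosure
import Literature.Analysis.FluidPDE.ElgindiHkDensity
import HarnessLib

/-!
# The second product rule on the closure class
([ElgindiGhoulMasmoudi2021] §9 Proposition 9.3 at `k = 4`, for `g` in the `𝓗⁴`-closure of the test functions)

Topic `Literature/Analysis/FluidPDE`. Support file (definitions with bodies and proved theorems, no
named facts) on the proof path of the named fact
`Literature.Analysis.FluidPDE.Elgindi.ElgindiGhoulMasmoudi2021_stabilityCore`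
(`ElgindiStabilityDecomposition.lean`). T. M. Elgindi, T.-E. Ghoul, N. Masmoudi, Camb. J. Math. 9
(2021) = arXiv:1910.14071, §9 Proposition 9.3 (p. 20).

`ElgindiWkProductRule.lean` proves `|fg|²_{𝓗⁴} ≤ prodWkC·M²·|g|²_{𝓗⁴}` for test functions `g`; here
the same bound, with the same constant, is extended to every `g` of the closure class `HkApprox`
(Fatou along an a.e.-convergent subsequence of the words, and `|g_n|_{𝓗⁴} → |g|_{𝓗⁴}`).
-/

noncomputable section

open MeasureTheory Set Function Real Filter Finset
open _root_.Topology
open scoped ENNReal ContDiff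

namespace Literature.Analysis.FluidPDE

namespace Elgindi

/-- **EGM Proposition 9.3 at `k = 4` on the closure class**: for `0 < α ≤ 10`, `f` smooth on the open
strip with `|f|_{𝓦^{4,∞}} ≤ M`, and `g` in the `𝓗⁴`-closure of the test functions,
`|fg|²_{𝓗⁴} ≤ prodWkC·M²·|g|²_{𝓗⁴}`. [cite: ElgindiGhoulMasmoudi2021, §9 Proposition 9.3 (p. 20 of arXiv:1910.14071)] -/
theorem eHkNormSq_mul_le_wk_closure {α : ℝ} (hα : 0 < α) (hα10 : α ≤ 10) {f g : ℝ → ℝ → ℝ} (hf : ContDiffOn ℝ ∞ (uncurry f) strip)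
    {M : ℝ} (hM0 : 0 ≤ M) (hM : eWkNorm α 4 f ≤ ENNReal.ofReal M) {gs : ℕ → ℝ → ℝ → ℝ} (hA : HkApprox α g gs) :
    eHkNormSq α 4 (f * g) ≤ ENNReal.ofReal (prodWkC * M ^ 2) * eHkNormSq α 4 g := by
  have h4 : (4 : WithTop ℕ∞) ≤ ((⊤ : ℕ∞) : WithTop ℕ∞) := WithTop.coe_le_coe.2 le_top
  set K : ℝ≥0∞ := ENNReal.ofReal (prodWkC * M ^ 2) with hK
  obtain ⟨ns, hns, hae⟩ := hA.exists_subseq_ae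
  have hA' : HkApprox α g (gs ∘ ns) := hA.subseq hns
  have hgs : ∀ n, ContDiffOn ℝ ∞ (uncurry (gs n)) strip := fun n => (contDiff_infty.2 (hA.test n).smooth).contDiffOn
  set hs : ℕ → ℝ → ℝ → ℝ := fun k => f * gs (ns k) with hhs
  -- words of `f·g_{n_k}` converge a.e. to those of `f·g`
  have hlim : ∀ᵐ p ∂(volume.restrict strip), ∀ i j, i + j ≤ 4 →
      Tendsto (fun k => (Dθ^[i] (Dz^[j] (hs k))) p.1 p.2) atTop (𝓝 ((Dθ^[i] (Dz^[j] (f * g))) p.1 p.2)) := by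
    filter_upwards [hae, ae_restrict_mem measurableSet_strip] with p h1 hp
    intro i j hij
    have ef : ∀ k, (Dθ^[i] (Dz^[j] (hs k))) p.1 p.2 = ∑ a ∈ range (j + 1), ∑ b ∈ range (i + 1),
        ((j.choose a : ℝ) * (i.choose b : ℝ)) * ((Dθ^[b] (Dz^[a] f)) p.1 p.2 * (Dθ^[i - b] (Dz^[j - a] (gs (ns k)))) p.1 p.2) := fun k =>
      iterate_Dθ_Dz_mul_strip hf (hgs _) i j hp
    simp_rw [ef]
    rw [iterate_Dθ_Dz_mul_strip hf hA.smooth i j hp]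
    refine tendsto_finsetSum _ fun a ha => tendsto_finsetSum _ fun b hb => ?_
    have ha' : a ≤ j := Nat.lt_succ_iff.1 (Finset.mem_range.1 ha)
    have hb' : b ≤ i := Nat.lt_succ_iff.1 (Finset.mem_range.1 hb)
    exact ((tendsto_const_nhds.mul (h1 (i - b) (j - a) (by omega))).const_mul _)
  have hfg4 : ContDiffOn ℝ 4 (uncurry (f * g)) strip := ((hf.of_le h4).mul (hA.smooth.of_le h4)).congr fun p _ => rfl
  have hhs4 : ∀ k, ContDiffOn ℝ 4 (uncurry (hs k)) strip := fun k => ((hf.of_le h4).mul ((hgs _).of_le h4)).congr fun p _ => rfl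
  have hFatou := eHkNormSq_le_liminf_ae α hfg4 hhs4 hlim
  have hk : ∀ k, eHkNormSq α 4 (hs k) ≤ K * eHkNormSq α 4 (gs (ns k)) := fun k =>
    eHkNormSq_mul_le_wk hα hα10 hf hM0 hM (hA.test _)
  have hT : Tendsto (fun k => K * eHkNormSq α 4 (gs (ns k))) atTop (𝓝 (K * eHkNormSq α 4 g)) :=
    ENNReal.Tendsto.const_mul hA'.tendsto_eHkNormSq (Or.inr ENNReal.ofReal_ne_top)
  calc eHkNormSq α 4 (f * g) ≤ liminf (fun k => eHkNormSq α 4 (hs k)) atTop := hFatou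
    _ ≤ liminf (fun k => K * eHkNormSq α 4 (gs (ns k))) atTop := liminf_le_liminf (Eventually.of_forall hk)
    _ = K * eHkNormSq α 4 g := hT.liminf_eq

/-- **The multiplier product rule at `k = 4` on the closure class**: `f` smooth on the strip with
the a.e. word bounds `|D_z^jf| ≤ B`, `|D_θ^iD_z^jf| ≤ (γ−1+sin 2θ)B` (`i ≥ 1`), `g ∈` closure:
`|fg|²_{𝓗⁴} ≤ prodBC·B²·|g|²_{𝓗⁴}`. [cite: ElgindiGhoulMasmoudi2021, §9 Proposition 9.3 (p. 20 of arXiv:1910.14071)] -/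
theorem eHkNormSq_mul_le_of_wordBounds_closure {α : ℝ} (hα : 0 < α) (hα10 : α ≤ 10) {f g : ℝ → ℝ → ℝ}
    (hf : ContDiffOn ℝ ∞ (uncurry f) strip) {B : ℝ} (hB0 : 0 ≤ B)
    (hB : ∀ᵐ p ∂(volume.restrict strip), ∀ i j : ℕ, i + j ≤ 4 →
      |(Dθ^[i] (Dz^[j] f)) p.1 p.2| ≤ (if i = 0 then 1 else qW α p.2) * B)
    {gs : ℕ → ℝ → ℝ → ℝ} (hA : HkApprox α g gs) :
    eHkNormSq α 4 (f * g) ≤ ENNReal.ofReal (prodBC * B ^ 2) * eHkNormSq α 4 g := by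
  have h4 : (4 : WithTop ℕ∞) ≤ ((⊤ : ℕ∞) : WithTop ℕ∞) := WithTop.coe_le_coe.2 le_top
  set K : ℝ≥0∞ := ENNReal.ofReal (prodBC * B ^ 2) with hK
  obtain ⟨ns, hns, hae⟩ := hA.exists_subseq_ae
  have hA' : HkApprox α g (gs ∘ ns) := hA.subseq hns
  have hgs : ∀ n, ContDiffOn ℝ ∞ (uncurry (gs n)) strip := fun n => (contDiff_infty.2 (hA.test n).smooth).contDiffOn
  set hs : ℕ → ℝ → ℝ → ℝ := fun k => f * gs (ns k) with hhs
  have hlim : ∀ᵐ p ∂(volume.restrict strip), ∀ i j, i + j ≤ 4 →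
      Tendsto (fun k => (Dθ^[i] (Dz^[j] (hs k))) p.1 p.2) atTop (𝓝 ((Dθ^[i] (Dz^[j] (f * g))) p.1 p.2)) := by
    filter_upwards [hae, ae_restrict_mem measurableSet_strip] with p h1 hp
    intro i j hij
    have ef : ∀ k, (Dθ^[i] (Dz^[j] (hs k))) p.1 p.2 = ∑ a ∈ range (j + 1), ∑ b ∈ range (i + 1),
        ((j.choose a : ℝ) * (i.choose b : ℝ)) * ((Dθ^[b] (Dz^[a] f)) p.1 p.2 * (Dθ^[i - b] (Dz^[j - a] (gs (ns k)))) p.1 p.2) := fun k =>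
      iterate_Dθ_Dz_mul_strip hf (hgs _) i j hp
    simp_rw [ef]
    rw [iterate_Dθ_Dz_mul_strip hf hA.smooth i j hp]
    refine tendsto_finsetSum _ fun a ha => tendsto_finsetSum _ fun b hb => ?_
    have ha' : a ≤ j := Nat.lt_succ_iff.1 (Finset.mem_range.1 ha)
    have hb' : b ≤ i := Nat.lt_succ_iff.1 (Finset.mem_range.1 hb)
    exact ((tendsto_const_nhds.mul (h1 (i - b) (j - a) (by omega))).const_mul _)
  have hfg4 : ContDiffOn ℝ 4 (uncurry (f * g)) strip := ((hf.of_le h4).mul (hA.smooth.of_le h4)).congr fun p _ => rfl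
  have hhs4 : ∀ k, ContDiffOn ℝ 4 (uncurry (hs k)) strip := fun k => ((hf.of_le h4).mul ((hgs _).of_le h4)).congr fun p _ => rfl
  have hFatou := eHkNormSq_le_liminf_ae α hfg4 hhs4 hlim
  have hk : ∀ k, eHkNormSq α 4 (hs k) ≤ K * eHkNormSq α 4 (gs (ns k)) := fun k =>
    eHkNormSq_mul_le_of_wordBounds hα hα10 hf hB0 hB (hA.test _)
  have hT : Tendsto (fun k => K * eHkNormSq α 4 (gs (ns k))) atTop (𝓝 (K * eHkNormSq α 4 g)) :=
    ENNReal.Tendsto.const_mul hA'.tendsto_eHkNormSq (Or.inr ENNReal.ofReal_ne_top)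
  calc eHkNormSq α 4 (f * g) ≤ liminf (fun k => eHkNormSq α 4 (hs k)) atTop := hFatou
    _ ≤ liminf (fun k => K * eHkNormSq α 4 (gs (ns k))) atTop := liminf_le_liminf (Eventually.of_forall hk)
    _ = K * eHkNormSq α 4 g := hT.liminf_eq

/-- The same for data with finite `𝓗⁴` functional and finite `γ`-words (the closure class, intrinsically). [cite: ElgindiGhoulMasmoudi2021, §9 Proposition 9.3 (p. 20 of arXiv:1910.14071)] -/
theorem eHkNormSq_mul_le_wk_of_finite {α : ℝ} (hα : 0 < α) (hα10 : α ≤ 10) {f g : ℝ → ℝ → ℝ} (hf : ContDiffOn ℝ ∞ (uncurry f) strip)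
    {M : ℝ} (hM0 : 0 ≤ M) (hM : eWkNorm α 4 f ≤ ENNReal.ofReal M)
    (hg : ContDiffOn ℝ ∞ (uncurry g) strip) (hE : eHkNormSq α 4 g < ⊤) (hH : gammaWords α g < ⊤) :
    eHkNormSq α 4 (f * g) ≤ ENNReal.ofReal (prodWkC * M ^ 2) * eHkNormSq α 4 g :=
  eHkNormSq_mul_le_wk_closure hα hα10 hf hM0 hM (hkApprox_cutFun α hg hE hH)

end Elgindi

end Literature.Analysis.FluidPDE
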